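import Mathlib
import HarnessLib
import HarnessLib.Audit
import Literature.Computability.AlgebraicComplexity.RealTauKnownCases
import Summits.ValiantsHypothesis.ValiantsHypothesis.Theorems.LacunarySymmetroidMatrixDescartesZeroChangeConcavityBudgetFloor

/-!
# ValiantsHypothesis / LacunarySymmetroid — crux `MatrixDescartes` (stmt-ValiantsHypothesis-18050, V1), LINE (A) «product_plus_one»:
# the CONCAVITY BUDGET for ARBITRARY companies (two-change rows allowed) and the window corollary for sector provers

Third part of the concavity budget (✓ `…ZeroChangeConcavityBudget`: abstract count; ✓ `…ZeroChangeConcavityBudgetFloor`: one-change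
companies, `OneChangeFloorK3` from a linear BAD-point budget).  The concavity criterion and the abstract count need NO sign hypothesis on
the rows, so the same bookkeeping serves the bottom-coupling (`l₀ = 0`) column of the stronger stubs `stub_eulerBoundK3 : EulerBoundK3` /
`stub_classRowK3 : ClassRowK3Linear`, whose residue «zero-free strict dips» consists exactly of two-change rows `(+,−,+)`:

* `card_support_row_le_three`, `card_posRoots_row_le_two`, `card_posRoots_prod_rows_le_two_mul` — a trinomial row has at most two positive
  roots (Descartes through ✓ `Literature.…card_roots_toFinset_filter_pos_lt_card_support`), a product of `m` rows at most `2m`;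
* ★ `posCrit_prod_rows_le_concavityBudget_anyRows` — ANY company on `0 < a < c`: `posCrit Φ ≤ 2·#BAD + 6m + 1`,
  BAD = `{t > 0 : Φ′(t) = 0, Φ(t) ≠ 0, M(t) ≤ 0}` (middle-letter Pick sum `M = middleSum`);
* ★ `eulerBottom_le_concavityBudget_anyRows` — Euler currency: on every sorted support `d₀ < d₁ < d₂` and for EVERY coefficient matrix `a`,
  `Z₊(eulerNumerator d a 0) ≤ 2·#BAD + 6m + 1` (unfolded as in ✓ `card_posRoots_euler_bottom_eq_posCrit`);
  `eulerBottom_of_badBudget_anyRows` — a linear bad-point budget over all companies gives the sorted bottom-coupling column of `EulerBoundK3`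
  with constant `2B + 6` (HONEST: `EulerBoundK3` also quantifies over unsorted / repeated supports and the couplings `l₀ = 1, 2`, which this
  file does not touch);
* `card_bad_le_posCrit` — the converse bookkeeping (bad points are critical points), so «linear bad budget» and «linear critical count» are
  EQUIVALENT cell by cell;
* ★ `card_crit_Ioo_le_one_of_middleSum_pos` — the corollary the per-window sector files want: on a root-free window on which `M > 0` at every
  critical point, a company has AT MOST ONE critical point (e.g. the late windows of a `(+,−,−)`/`(+,+,+)` company: every switched `(+,−,−)` row
  and every `(+,+,+)` row pushes `M` up).

HONEST FRAMING: joint / helper, def-free, no named facts, no sorry, standard axioms; closes NO stub by name; `OneChangeFloorK3`, `EulerBoundK3`,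
`ClassRowK3Linear`, `PPOPolyLaw`, `MatrixDescartes` (stmt-ValiantsHypothesis-18050) OPEN; `VP ≠ VNP` is NOT proved and nothing here bears on it.

[folklore] Descartes' rule for three monomials and elementary counting; no citation needed.
-/

set_option linter.dupNamespace false

namespace Summit.ValiantsHypothesis.ValiantsHypothesis.Theorems.LacunarySymmetroidMatrixDescartes

namespace ZeroChange

open Polynomial Finset Filter Topology

/-! ## Rows with any sign pattern: at most two positive roots -/

/-- A trinomial row has at most three monomials. -/
theorem card_support_row_le_three (a c : ℕ) (p q s : ℝ) : (row a c p q s).support.card ≤ 3 := by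
  classical
  have hsub : (row a c p q s).support ⊆ ({0, a, c} : Finset ℕ) := by
    intro n hn
    rw [mem_support_iff, row] at hn
    simp only [mem_insert, mem_singleton]
    by_contra h
    push Not at h
    apply hn
    simp [coeff_C, h.1, h.2.1, h.2.2]
  exact (card_le_card hsub).trans Finset.card_le_three

/-- **A trinomial row has at most two positive roots** (Descartes: fewer positive roots than monomials; the zero row has none). -/
theorem card_posRoots_row_le_two (a c : ℕ) (p q s : ℝ) :
    ((row a c p q s).roots.toFinset.filter (fun t => 0 < t)).card ≤ 2 := by
  classical
  by_cases h0 : row a c p q s = 0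
  · rw [h0, roots_zero, Multiset.toFinset_zero, filter_empty, card_empty]
    exact Nat.zero_le _
  have h1 := Literature.Computability.AlgebraicComplexity.card_roots_toFinset_filter_pos_lt_card_support h0
  have h2 := card_support_row_le_three a c p q s
  omega

/-- **A product of `m` trinomial rows has at most `2m` distinct positive roots.** -/
theorem card_posRoots_prod_rows_le_two_mul (m a c : ℕ) (co : Fin m → ℝ × ℝ × ℝ) :
    ((∏ j, row a c (co j).1 (co j).2.1 (co j).2.2).roots.toFinset.filter (fun t => 0 < t)).card ≤ 2 * m := by
  classical
  set Φ : ℝ[X] := ∏ j, row a c (co j).1 (co j).2.1 (co j).2.2 with hΦdef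
  by_cases hΦ : Φ = 0
  · rw [hΦ, roots_zero, Multiset.toFinset_zero, filter_empty, card_empty]
    exact Nat.zero_le _
  have hrow : ∀ j, row a c (co j).1 (co j).2.1 (co j).2.2 ≠ 0 := by
    intro j hj
    exact hΦ (prod_eq_zero (mem_univ j) hj)
  have hsub : Φ.roots.toFinset.filter (fun t => 0 < t) ⊆
      Finset.univ.biUnion (fun j => (row a c (co j).1 (co j).2.1 (co j).2.2).roots.toFinset.filter (fun t => 0 < t)) := by
    intro t ht
    rw [mem_filter, Multiset.mem_toFinset, mem_roots hΦ, IsRoot.def, hΦdef, eval_prod, prod_eq_zero_iff] at ht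
    obtain ⟨⟨j, -, hj⟩, ht0⟩ := ht
    rw [mem_biUnion]
    refine ⟨j, mem_univ j, ?_⟩
    rw [mem_filter, Multiset.mem_toFinset, mem_roots (hrow j)]
    exact ⟨hj, ht0⟩
  calc (Φ.roots.toFinset.filter (fun t => 0 < t)).card
      ≤ (Finset.univ.biUnion (fun j => (row a c (co j).1 (co j).2.1 (co j).2.2).roots.toFinset.filter
          (fun t => 0 < t))).card := card_le_card hsub
    _ ≤ ∑ j, ((row a c (co j).1 (co j).2.1 (co j).2.2).roots.toFinset.filter (fun t => 0 < t)).card := card_biUnion_le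
    _ ≤ ∑ _j : Fin m, 2 := sum_le_sum fun j _ => card_posRoots_row_le_two a c _ _ _
    _ = 2 * m := by simp [mul_comm]

/-! ## The budget for arbitrary companies -/

/-- ★ **CONCAVITY BUDGET, ANY company** (`0 < a < c`, rows of any sign pattern, degenerate letters allowed):
`posCrit Φ ≤ 2·#{t > 0 : Φ′(t) = 0, Φ(t) ≠ 0, M(t) ≤ 0} + 6m + 1`. -/
theorem posCrit_prod_rows_le_concavityBudget_anyRows (m a c : ℕ) (ha : 0 < a) (hac : a < c) (co : Fin m → ℝ × ℝ × ℝ) :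
    posCrit (∏ j, row a c (co j).1 (co j).2.1 (co j).2.2) ≤
      2 * (((derivative (∏ j, row a c (co j).1 (co j).2.1 (co j).2.2)).roots.toFinset.filter (fun t => 0 < t)).filter
          (fun t => (∏ j, row a c (co j).1 (co j).2.1 (co j).2.2).eval t ≠ 0 ∧ middleSum a c co t ≤ 0)).card
        + 6 * m + 1 := by
  have h1 := posCrit_prod_rows_le_concavityBudget m a c ha hac co
  have h2 := card_posRoots_prod_rows_le_two_mul m a c co
  omega

/-- ★ **Euler currency, ANY company at the bottom coupling**: on a sorted support `d₀ < d₁ < d₂`,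
`Z₊(eulerNumerator d a 0) ≤ 2·#BAD + 6m + 1` for EVERY coefficient matrix `a` (the `l₀ = 0`, sorted-support column of `EulerBoundK3`). -/
theorem eulerBottom_le_concavityBudget_anyRows {m : ℕ} (d : Fin 3 → ℕ) (h01 : d 0 < d 1) (h12 : d 1 < d 2)
    (a : Fin m → Fin 3 → ℝ) :
    ((∑ j, (∑ l, C (a j l * ((d l : ℝ) - d 0)) * X ^ (d l)) * ∏ i ∈ Finset.univ.erase j, (∑ l, C (a i l) * X ^ (d l))
        : ℝ[X]).roots.toFinset.filter (fun t => 0 < t)).card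
      ≤ 2 * (((derivative (∏ j, row (d 1 - d 0) (d 2 - d 0) (a j 0) (a j 1) (a j 2))).roots.toFinset.filter
            (fun t => 0 < t)).filter
          (fun t => (∏ j, row (d 1 - d 0) (d 2 - d 0) (a j 0) (a j 1) (a j 2)).eval t ≠ 0 ∧
            middleSum (d 1 - d 0) (d 2 - d 0) (fun j => (a j 0, a j 1, a j 2)) t ≤ 0)).card + 6 * m + 1 := by
  rw [card_posRoots_euler_bottom_eq_posCrit d h01.le (h01.le.trans h12.le) a]
  exact posCrit_prod_rows_le_concavityBudget_anyRows m (d 1 - d 0) (d 2 - d 0) (by omega) (by omega)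
    (fun j => (a j 0, a j 1, a j 2))

/-- **The sorted bottom-coupling column of `EulerBoundK3` from a linear bad-point budget over ALL companies** (constant `2B + 6`).
HONEST: `EulerBoundK3` itself also quantifies over unsorted / repeated supports and over the couplings `l₀ = 1, 2`; those columns are not
touched here. -/
theorem eulerBottom_of_badBudget_anyRows (B : ℕ)
    (hbudget : ∀ (m u w : ℕ), 0 < u → u < w → ∀ (co : Fin m → ℝ × ℝ × ℝ),
      (((derivative (∏ j, row u w (co j).1 (co j).2.1 (co j).2.2)).roots.toFinset.filter (fun t => 0 < t)).filter
          (fun t => (∏ j, row u w (co j).1 (co j).2.1 (co j).2.2).eval t ≠ 0 ∧ middleSum u w co t ≤ 0)).card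
        ≤ B * m + B) :
    ∀ (m : ℕ) (d : Fin 3 → ℕ) (a : Fin m → Fin 3 → ℝ), d 0 < d 1 → d 1 < d 2 →
      ((∑ j, (∑ l, C (a j l * ((d l : ℝ) - d 0)) * X ^ (d l)) * ∏ i ∈ Finset.univ.erase j, (∑ l, C (a i l) * X ^ (d l))
          : ℝ[X]).roots.toFinset.filter (fun t => 0 < t)).card ≤ (2 * B + 6) * m + (2 * B + 6) := by
  intro m d a h01 h12
  have h1 := eulerBottom_le_concavityBudget_anyRows d h01 h12 a
  have h2 : (((derivative (∏ j, row (d 1 - d 0) (d 2 - d 0) (a j 0) (a j 1) (a j 2))).roots.toFinset.filter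
            (fun t => 0 < t)).filter
          (fun t => (∏ j, row (d 1 - d 0) (d 2 - d 0) (a j 0) (a j 1) (a j 2)).eval t ≠ 0 ∧
            middleSum (d 1 - d 0) (d 2 - d 0) (fun j => (a j 0, a j 1, a j 2)) t ≤ 0)).card ≤ B * m + B :=
    hbudget m (d 1 - d 0) (d 2 - d 0) (by omega) (by omega) (fun j => (a j 0, a j 1, a j 2))
  have h3 : (2 * B + 6) * m + (2 * B + 6) = 2 * (B * m + B) + 6 * m + 1 + 5 := by ring
  rw [h3]
  omega

/-! ## The converse bookkeeping and the window corollary -/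

/-- Bad points are critical points: `#BAD ≤ posCrit Φ` (so a linear critical count and a linear bad budget are equivalent, cell by cell). -/
theorem card_bad_le_posCrit (m a c : ℕ) (co : Fin m → ℝ × ℝ × ℝ) :
    (((derivative (∏ j, row a c (co j).1 (co j).2.1 (co j).2.2)).roots.toFinset.filter (fun t => 0 < t)).filter
        (fun t => (∏ j, row a c (co j).1 (co j).2.1 (co j).2.2).eval t ≠ 0 ∧ middleSum a c co t ≤ 0)).card
      ≤ posCrit (∏ j, row a c (co j).1 (co j).2.1 (co j).2.2) := by
  rw [posCrit]
  exact card_filter_le _ _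

/-- ★ **Window corollary**: on a root-free window `(u, v)` of a company on `0 < a < c` on which the middle-letter sum is positive at every
critical point, there is AT MOST ONE critical point. -/
theorem card_crit_Ioo_le_one_of_middleSum_pos (m a c : ℕ) (ha : 0 < a) (hac : a < c) (co : Fin m → ℝ × ℝ × ℝ) {u v : ℝ}
    (hnoroot : ∀ z, u < z → z < v → (∏ j, row a c (co j).1 (co j).2.1 (co j).2.2).eval z ≠ 0)
    (hM : ∀ t, u < t → t < v → (derivative (∏ j, row a c (co j).1 (co j).2.1 (co j).2.2)).eval t = 0 →
      0 < middleSum a c co t) :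
    (((derivative (∏ j, row a c (co j).1 (co j).2.1 (co j).2.2)).roots.toFinset.filter (fun t => 0 < t)).filter
        (fun t => u < t ∧ t < v)).card ≤ 1 := by
  classical
  set Φ : ℝ[X] := ∏ j, row a c (co j).1 (co j).2.1 (co j).2.2 with hΦdef
  have h := card_crit_Ioo_prod_rows_le m a c ha hac co hnoroot
  have h0 : (((derivative Φ).roots.toFinset.filter (fun t => 0 < t)).filter
      (fun t => (u < t ∧ t < v) ∧ middleSum a c co t ≤ 0)) = ∅ := by
    rw [Finset.eq_empty_iff_forall_notMem]
    intro t ht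
    rw [mem_filter, mem_filter, Multiset.mem_toFinset] at ht
    obtain ⟨⟨hmem, -⟩, ⟨htu, htv⟩, hMle⟩ := ht
    have hΦ' : derivative Φ ≠ 0 := fun h => by rw [h, roots_zero] at hmem; exact Multiset.notMem_zero _ hmem
    have hcrit : (derivative Φ).eval t = 0 := (mem_roots hΦ').1 hmem
    exact absurd (hM t htu htv hcrit) (not_lt.2 hMle)
  rw [h0, card_empty] at h
  omega

end ZeroChange

end Summit.ValiantsHypothesis.ValiantsHypothesis.Theorems.LacunarySymmetroidMatrixDescartes
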